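import Literature.Analysis.FluidPDE.FujitaKatoL2Fourier
import Literature.Analysis.FluidPDE.FujitaKatoTestFields
import Literature.Analysis.FluidPDE.FujitaKatoLimit
import Literature.Analysis.FunctionSpaces.LpJointMeasurable
import HarnessLib

/-!
# From the Fourier side to duality-form mild solutions: the Fujita–Kato dictionary

Final file of the discharge programme for the named fact
`Literature.Analysis.FluidPDE.fujita_kato_local` (plan and assembly:
`Literature/Analysis/FluidPDE/FujitaKatoLocal.lean`). It proves the dictionary fact
`FujitaKato.exists_mildSolution_of_isFourierNSSolution` — a Fourier-side solution `v` of the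
Fujita–Kato class (`IsFourierNSSolution`, rate `c = (2π)²ν`, data `a = û₀(-·)`) yields a physical
field `u` which is a duality-form mild solution (`IsMildNSSolutionOn`, Fabes–Jones–Rivière 1972,
Thm. 2.1) in `C([0,T); Ḣ^{1/2} ∩ L²)`, jointly measurable, with `u(0) = u₀` — and assembles
`fujita_kato_local_holds` from it and the accepted Fourier-side existence theorem
`fourier_fujitaKato_local_holds` (`FujitaKatoLimit.lean`) through `fujita_kato_local_of`.

The dictionary is Lemarié-Rieusset 2023, §8.7, (8.8), PDF p. 198 ("Let `U` be the (spatial)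
Fourier transform of `u` … We find (8.8)"), read from right to left:

1. **The field.** `U(t) = 𝓕⁻¹[v(t,-·)] ∈ L²(ℝ³; ℂ³)` (`physLp`, file `FujitaKatoL2Fourier.lean`),
   continuous in `t` (`tendsto_sq`), a.e. real (Hermitian symmetry of `v(t)`); `u(t)` is the real
   part of a jointly measurable version of `t ↦ U(t)`
   (`Literature.Analysis.FunctionSpaces.exists_measurable_uncurry_of_continuousOn_Lp`), and
   `u(0) = u₀` (`U(0) = 𝓕⁻¹𝓕 u₀ = u₀`).
2. **The pairings.** For Schwartz `Θ_l`, `∫ ⟪u(t), Θ⟫ = ∫ ∑ v_l(t) 𝓕Θ_l` (Plancherel,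
   `integral_sum_conj_physLp_mul`) and `∫ u_j u_l θ = ∫ (v_j ⋆ v_l) 𝓕θ`
   (`integral_physLp_mul_physLp_mul`). With the caloric test fields of `FujitaKatoTestFields.lean`
   (`caloricSchwartz`: `(e^{νσΔ}φ)_l = 𝓕⁻¹(e^{-(2π)²νσ|ξ|²} Φ_l)`, its derivatives, and
   `∑ ζ_l Φ_l = 0`) the nonlinear duality term becomes
   `∫ ⟪u(τ), (u(τ)·∇) e^{ν(t-τ)Δ}φ⟫ = -∫ e^{-c(t-τ)|ζ|²} Φ(ζ) · N(v(τ), v(τ))(ζ) dζ`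
   (`N = FourierNS.nonlin`; the Leray symbol drops out against the divergence-free `Φ`).
3. **The identity.** Fubini over `(0,t) × ℝ³` and the Fourier-side Duhamel formula (a.e. in `ζ`)
   give `∫₀ᵗ ∫ ⟪u, (u·∇) e^{ν(t-τ)Δ}φ⟫ = ∫ Φ · v(t) − ∫ e^{-ct|ζ|²} Φ · a = ∫⟪u(t), φ⟫ − ∫⟪u₀, e^{νtΔ}φ⟫`,
   i.e. `IsMildNSSolutionFrom ν 0 u₀ u t`; weak divergence-freeness of `u(t)` is `ξ · v(t,ξ) = 0`.
4. **The classes.** `𝓕(u(t) − u(t₀)) = v(t,-·) − v(t₀,-·)`, so `ContinuousInLpOn … 2` and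
   `ContinuousInHomSobolevOn … (1/2)` are `tendsto_sq` and `tendsto_weighted`.

## Mathlib / tree search

Everything used is listed in the imported files' headers; in addition `intervalIntegral.integral_ofReal`,
`integral_ofReal`, `integral_integral_swap`, `integrable_prod_iff`, `Lp.ext`, `Lp.edist_toLp_toLp`,
`MeasureTheory.lintegral_withDensity_eq_lintegral_mul`, `ENNReal.lintegral_mul_le_Lp_mul_Lq`.
Tree lemmas reused: `continuous_reCoords` / `reCoords_complexify` (`FujitaKatoLocal.lean`),
`exists_measurable_uncurry_of_continuousOn_Lp` (`LpJointMeasurable.lean`), `enorm_nonlin_le`,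
`enorm_fconv_le_eLpNorm_mul`, `measurable_nonlin_uncurry` (`FujitaKatoPicard.lean`,
`FujitaKatoL2Fourier.lean`). Near-twins NOT imported (their files `NSFourierAPriori.lean`,
`NSFourierSolution.lean`, `FourierL2Convolution.lean` serve the disjoint Leray-regular / `L¹`
developments, the last one for Mathlib's `⋆ₗ` rather than `FourierNS.lconv`):
`FourierNS.fconv_comm` (restated as `fconv_comm'`, 3 lines), `FourierNS.inner_eq_sum'`
(complexified here as `ofReal_inner_eq_sum`), `FourierNS.lconv_le_sqrt_mul_sqrt` (here
`lconv_enorm_le_lintegral_sq` for `FourierNS.lconv` with equal factors).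

## References

* P. G. Lemarié-Rieusset, *The Navier–Stokes problem in the 21st century*, 2nd ed., CRC Press
  2023, §8.7 (8.8), PDF p. 198; Thm. 6.1, PDF p. 135; Thm. 7.4 (A), PDF p. 151. [Lemarierieusset2023]
* E. B. Fabes, B. F. Jones, N. M. Rivière, Arch. Rational Mech. Anal. 45 (1972), Thm. 2.1.
* H. Fujita, T. Kato, Arch. Rational Mech. Anal. 16 (1964), 269–315.
-/

noncomputable section

open MeasureTheory Set Function Filter Topology Real SchwartzMap FourierTransform TopologicalSpace
open scoped ENNReal NNReal ComplexConjugate InnerProductSpace LineDeriv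

namespace Literature.Analysis.FluidPDE.FujitaKato

open FourierNS UnboundedOperators Literature.Analysis.FunctionSpaces

/-- Local notation for physical / frequency space `ℝ³ = EuclideanSpace ℝ (Fin 3)`. -/
local notation "ℝ³" => EuclideanSpace ℝ (Fin 3)

/-- Local notation for the complexified target `ℂ³ = EuclideanSpace ℂ (Fin 3)`. -/
local notation "ℂ³" => EuclideanSpace ℂ (Fin 3)

/-! ### The physical `L²` classes of a Fourier-side solution -/

section Classes

variable {c T : ℝ} {a : ℝ³ → Fin 3 → ℂ} {v : ℝ → ℝ³ → Fin 3 → ℂ}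

/-- Time slices of a Fourier-side solution are measurable. [folklore] -/
theorem IsFourierNSSolution.measurable_slice (hv : IsFourierNSSolution c T a v) (t : ℝ) :
    Measurable (v t) :=
  hv.measurable.comp (f := fun ξ : ℝ³ => (t, ξ)) (by fun_prop)

/-- Time slices of a Fourier-side solution are square integrable on `[0, T]`. [folklore] -/
theorem IsFourierNSSolution.sq_lt_top (hv : IsFourierNSSolution c T a v) {t : ℝ} (ht : t ∈ Icc 0 T) :
    ∫⁻ ξ, ‖v t ξ‖ₑ ^ 2 < ∞ := by
  obtain ⟨C, hC⟩ := hv.sq_le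
  exact lt_of_le_of_lt (hC t ht) ENNReal.coe_lt_top

/-- **The physical `L²` class at time `t`**: `U(t) = 𝓕⁻¹[v(t,-·)]` on `[0, T]` (and `0`, a junk
value, where the slice is not square integrable). [cite: Lemarierieusset2023, §8.7 (8.8) (PDF p. 198)] -/
def IsFourierNSSolution.physClass (hv : IsFourierNSSolution c T a v) (t : ℝ) :
    Lp ℂ³ 2 (volume : Measure ℝ³) :=
  if h : ∫⁻ ξ, ‖v t ξ‖ₑ ^ 2 < ∞ then physLp (hv.measurable_slice t) h else 0

/-- On `[0, T]` the physical class is `physLp`. [folklore] -/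
theorem IsFourierNSSolution.physClass_eq (hv : IsFourierNSSolution c T a v) {t : ℝ} (ht : t ∈ Icc 0 T) :
    hv.physClass t = physLp (hv.measurable_slice t) (hv.sq_lt_top ht) := by
  rw [IsFourierNSSolution.physClass, dif_pos (hv.sq_lt_top ht)]

/-- The distance between two physical classes is the `L²` distance of the slices on the Fourier
side (Plancherel): `edist (U t) (U t₀) ≤ 3 (∫⁻ ‖v t − v t₀‖²)^{1/2}`. [folklore] -/
theorem IsFourierNSSolution.edist_physClass_le (hv : IsFourierNSSolution c T a v) {t t₀ : ℝ}
    (ht : t ∈ Icc 0 T) (ht₀ : t₀ ∈ Icc 0 T) :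
    edist (hv.physClass t) (hv.physClass t₀) ≤
      (Fintype.card (Fin 3) : ℝ≥0∞) * (∫⁻ ξ, ‖v t ξ - v t₀ ξ‖ₑ ^ 2) ^ (1 / 2 : ℝ) := by
  rw [hv.physClass_eq ht, hv.physClass_eq ht₀, physLp, physLp]
  rw [show ∀ A B : Lp ℂ³ 2 (volume : Measure ℝ³), edist ((𝓕⁻ A : Lp ℂ³ 2 (volume : Measure ℝ³)))
      ((𝓕⁻ B : Lp ℂ³ 2 (volume : Measure ℝ³))) = edist A B from fun A B =>
      (Lp.fourierTransformₗᵢ ℝ³ ℂ³).symm.isometry.edist_eq A B, Lp.edist_toLp_toLp]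
  have hsub : negEuc (v t) - negEuc (v t₀) = negEuc (fun ξ => v t ξ - v t₀ ξ) := by
    funext ξ
    simp [negEuc, toEuc_sub]
  rw [hsub, eLpNorm_eq_lintegral_rpow_enorm_toReal (by norm_num) (by norm_num)]
  simp only [ENNReal.toReal_ofNat, ENNReal.rpow_ofNat]
  have h := lintegral_enorm_negEuc_sq_le (fun ξ => v t ξ - v t₀ ξ)
  calc (∫⁻ ξ, ‖negEuc (fun ξ => v t ξ - v t₀ ξ) ξ‖ₑ ^ 2) ^ (1 / (2 : ℝ))
      ≤ ((Fintype.card (Fin 3) : ℝ≥0∞) ^ 2 * ∫⁻ ξ, ‖v t ξ - v t₀ ξ‖ₑ ^ 2) ^ (1 / (2 : ℝ)) := by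
        gcongr
    _ = (Fintype.card (Fin 3) : ℝ≥0∞) * (∫⁻ ξ, ‖v t ξ - v t₀ ξ‖ₑ ^ 2) ^ (1 / 2 : ℝ) := by
        rw [ENNReal.mul_rpow_of_nonneg _ _ (by norm_num), ← ENNReal.rpow_natCast, ← ENNReal.rpow_mul]
        norm_num

/-- **Continuity of `t ↦ U(t)` in `L²` on `[0, T]`** (`tendsto_sq` and Plancherel). [cite: Lemarierieusset2023, Thm. 7.4 (A) (PDF p. 151)] -/
theorem IsFourierNSSolution.continuousOn_physClass (hv : IsFourierNSSolution c T a v) :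
    ContinuousOn hv.physClass (Icc 0 T) := by
  intro t₀ ht₀
  rw [ContinuousWithinAt, EMetric.tendsto_nhds]
  intro ε hε
  have h0 : Tendsto (fun t => (Fintype.card (Fin 3) : ℝ≥0∞) * (∫⁻ ξ, ‖v t ξ - v t₀ ξ‖ₑ ^ 2) ^ (1 / 2 : ℝ))
      (𝓝[Icc 0 T] t₀) (𝓝 0) := by
    have h1 := (ENNReal.continuous_rpow_const (y := (1 / 2 : ℝ))).tendsto 0
    rw [ENNReal.zero_rpow_of_pos (by norm_num)] at h1
    have h2 := h1.comp (hv.tendsto_sq t₀ ht₀)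
    have h3 := ENNReal.Tendsto.const_mul h2 (Or.inr (ENNReal.natCast_ne_top _))
      (a := (Fintype.card (Fin 3) : ℝ≥0∞))
    rw [mul_zero] at h3
    exact h3
  filter_upwards [(tendsto_order.1 h0).2 ε hε, eventually_mem_nhdsWithin] with t h1 h2
  exact lt_of_le_of_lt (hv.edist_physClass_le h2 ht₀) h1

/-- **The physical class is real**: `conj (U(t) x)_l = (U(t) x)_l` a.e. (Hermitian symmetry). [folklore] -/
theorem IsFourierNSSolution.physClass_conj_ae (hv : IsFourierNSSolution c T a v) {t : ℝ} (ht : t ∈ Icc 0 T) :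
    ∀ᵐ x : ℝ³ ∂volume, ∀ l, conj ((hv.physClass t : ℝ³ → ℂ³) x l) = (hv.physClass t : ℝ³ → ℂ³) x l := by
  rw [hv.physClass_eq ht]
  exact physLp_conj_ae _ _ (hv.conjSymm t ht)

/-- **The physical class at time `0` is the datum**: `U(0) = u₀` (as `L²` classes), when
`a(-ξ) = 𝓕u₀(ξ)`. [folklore] -/
theorem IsFourierNSSolution.physClass_zero_ae_eq (hv : IsFourierNSSolution c T a v) (hT : 0 ≤ T)
    {u₀ : ℝ³ → ℝ³} (hu₀ : MemLp (FunctionSpaces.EuclideanSpace.complexify ∘ u₀) 2 (volume : Measure ℝ³))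
    (ha : ∀ᵐ ξ : ℝ³ ∂volume, ∀ j, a (-ξ) j =
      ((𝓕 (hu₀.toLp (FunctionSpaces.EuclideanSpace.complexify ∘ u₀)) : Lp ℂ³ 2 (volume : Measure ℝ³)) :
        ℝ³ → ℂ³) ξ j) :
    (hv.physClass 0 : ℝ³ → ℂ³) =ᵐ[volume] FunctionSpaces.EuclideanSpace.complexify ∘ u₀ := by
  have h0 : (0 : ℝ) ∈ Icc 0 T := ⟨le_rfl, hT⟩
  rw [hv.physClass_eq h0, physLp]
  have hA : (memLp_negEuc (hv.measurable_slice 0) (hv.sq_lt_top h0)).toLp (negEuc (v 0)) =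
      (𝓕 (hu₀.toLp (FunctionSpaces.EuclideanSpace.complexify ∘ u₀)) : Lp ℂ³ 2 (volume : Measure ℝ³)) := by
    refine Lp.ext ?_
    filter_upwards [MemLp.coeFn_toLp (memLp_negEuc (hv.measurable_slice 0) (hv.sq_lt_top h0)), ha]
      with ξ h1 h2
    rw [h1, hv.initial]
    ext j
    rw [negEuc_apply, h2 j]
  rw [hA, fourierInv_fourier_eq]
  exact MemLp.coeFn_toLp _

end Classes

/-! ### The physical field -/

section Field

variable {ν T : ℝ} {u₀ : ℝ³ → ℝ³} {a : ℝ³ → Fin 3 → ℂ} {v : ℝ → ℝ³ → Fin 3 → ℂ}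

/-- **Standing data of the dictionary**: a viscosity `ν > 0`, a horizon `T > 0`, a weakly
divergence-free finite-energy datum `u₀`, its Fourier data `a(ξ) = û₀(-ξ)`, and a Fourier-side
solution `v` in the Fujita–Kato class with rate `c = (2π)²ν` (the hypotheses of
`exists_mildSolution_of_isFourierNSSolution`). [cite: Lemarierieusset2023, §8.7 (8.8) (PDF p. 198)] -/
structure DictHyp (ν T : ℝ) (u₀ : ℝ³ → ℝ³) (a : ℝ³ → Fin 3 → ℂ) (v : ℝ → ℝ³ → Fin 3 → ℂ) : Prop where
  /-- The viscosity is positive. -/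
  ν_pos : 0 < ν
  /-- The horizon is positive. -/
  T_pos : 0 < T
  /-- The datum has finite energy. -/
  memLp : MemLp (FunctionSpaces.EuclideanSpace.complexify ∘ u₀) 2 (volume : Measure ℝ³)
  /-- The datum is weakly divergence free. -/
  divFree : IsWeaklyDivFree u₀
  /-- The Fourier data is the reflected transform of the datum. -/
  datum : ∀ᵐ ξ : ℝ³ ∂volume, ∀ j, a (-ξ) j =
    ((𝓕 (memLp.toLp (FunctionSpaces.EuclideanSpace.complexify ∘ u₀)) : Lp ℂ³ 2 (volume : Measure ℝ³)) :
      ℝ³ → ℂ³) ξ j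
  /-- `v` is a Fourier-side solution in the Fujita–Kato class with rate `(2π)²ν`. -/
  sol : IsFourierNSSolution ((2 * π) ^ 2 * ν) T a v

namespace DictHyp

variable (h : DictHyp ν T u₀ a v)
include h

/-- A jointly measurable version of `t ↦ U(t)` exists. [folklore] -/
theorem exists_version : ∃ g : ℝ → ℝ³ → ℂ³, Measurable (uncurry g) ∧
    ∀ t ∈ Icc 0 T, g t =ᵐ[volume] (h.sol.physClass t : ℝ³ → ℂ³) :=
  exists_measurable_uncurry_of_continuousOn_Lp _ h.sol.continuousOn_physClass

/-- The chosen jointly measurable version of `t ↦ U(t)`. [folklore] -/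
def version : ℝ → ℝ³ → ℂ³ := h.exists_version.choose

/-- The version is jointly measurable. [folklore] -/
theorem measurable_version : Measurable (uncurry h.version) := h.exists_version.choose_spec.1

/-- The version is the physical class at every `t ∈ [0, T]`. [folklore] -/
theorem version_ae_eq {t : ℝ} (ht : t ∈ Icc 0 T) : h.version t =ᵐ[volume] (h.sol.physClass t : ℝ³ → ℂ³) :=
  h.exists_version.choose_spec.2 t ht

omit h in
/-- Coordinatewise real parts `ℂ³ → ℝ³` (the map of `continuous_reCoords` / `reCoords_complexify`,
`FujitaKatoLocal.lean`, named). [folklore] -/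
def reC (y : ℂ³) : ℝ³ := WithLp.toLp 2 fun j => (y j).re

omit h in
/-- `reC` is continuous. [folklore] -/
theorem continuous_reC : Continuous reC := continuous_reCoords

omit h in
/-- `reC` is a left inverse of the complexification. [folklore] -/
theorem reC_complexify (w : ℝ³) : reC (FunctionSpaces.EuclideanSpace.complexify w) = w := reCoords_complexify w

omit h in
/-- A real vector is the complexification of its real parts. [folklore] -/
theorem complexify_reC {y : ℂ³} (hy : ∀ l, conj (y l) = y l) : FunctionSpaces.EuclideanSpace.complexify (reC y) = y := by
  ext l
  simp only [FunctionSpaces.EuclideanSpace.complexify_apply, reC]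
  exact Complex.conj_eq_iff_re.1 (hy l)

/-- **The physical field** `u(t) = Re U(t)` (real parts of the jointly measurable version), with
`u(0) = u₀`. [cite: Lemarierieusset2023, §8.7 (8.8) (PDF p. 198)] -/
def field : ℝ → ℝ³ → ℝ³ := fun t x => if t = 0 then u₀ x else reC (h.version t x)

/-- `u(0) = u₀`. [folklore] -/
theorem field_zero : h.field 0 = u₀ := by
  funext x
  simp [field]

/-- **The field is the physical class**: `u(t)^ℂ = U(t)` a.e., for every `t ∈ [0, T]`. [folklore] -/
theorem complexify_field_ae_eq {t : ℝ} (ht : t ∈ Icc 0 T) :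
    (FunctionSpaces.EuclideanSpace.complexify ∘ h.field t) =ᵐ[volume] (h.sol.physClass t : ℝ³ → ℂ³) := by
  rcases eq_or_ne t 0 with rfl | ht0
  · rw [field_zero]
    exact (h.sol.physClass_zero_ae_eq h.T_pos.le h.memLp h.datum).symm
  · filter_upwards [h.version_ae_eq ht, h.sol.physClass_conj_ae ht] with x h1 h2
    simp only [Function.comp_apply, field, if_neg ht0, h1]
    exact complexify_reC h2

/-- Coordinates of the field as complex numbers: `(u(t,x)_l : ℂ) = conj (U(t) x)_l` a.e. [folklore] -/
theorem ofReal_field_ae_eq {t : ℝ} (ht : t ∈ Icc 0 T) :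
    ∀ᵐ x : ℝ³ ∂volume, ∀ l, ((h.field t x l : ℝ) : ℂ) = conj ((h.sol.physClass t : ℝ³ → ℂ³) x l) := by
  filter_upwards [h.complexify_field_ae_eq ht, h.sol.physClass_conj_ae ht] with x h1 h2 l
  rw [h2 l, ← h1, Function.comp_apply, FunctionSpaces.EuclideanSpace.complexify_apply]

/-! ### The pairings -/

/-- **The linear pairing of the field**: if `(P(x) : ℂ) = ∑_l (u(t,x)_l : ℂ) Θ_l(x)` pointwise,
then `(∫ P : ℂ) = ∫ ∑_l v(t,ζ)_l 𝓕Θ_l(ζ) dζ` (`integral_sum_conj_physLp_mul`). [cite: Lemarierieusset2023, §8.7 (8.8) (PDF p. 198)] -/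
theorem pair {t : ℝ} (ht : t ∈ Icc 0 T) {P : ℝ³ → ℝ} (Θ : Fin 3 → 𝓢(ℝ³, ℂ))
    (hP : ∀ x, ((P x : ℝ) : ℂ) = ∑ l, ((h.field t x l : ℝ) : ℂ) * Θ l x) :
    ((∫ x, P x : ℝ) : ℂ) = ∫ ζ, ∑ l, v t ζ l * 𝓕 (Θ l : ℝ³ → ℂ) ζ := by
  rw [show ((∫ x, P x : ℝ) : ℂ) = ∫ x, ((P x : ℝ) : ℂ) from integral_ofReal.symm]
  simp_rw [hP]
  rw [← integral_sum_conj_physLp_mul (h.sol.measurable_slice t) (h.sol.sq_lt_top ht) (h.sol.conjSymm t ht) Θ,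
    ← h.sol.physClass_eq ht]
  refine integral_congr_ae ?_
  filter_upwards [h.ofReal_field_ae_eq ht] with x hx
  exact Finset.sum_congr rfl fun l _ => by rw [hx l]

/-- **The quadratic pairing of the field**: `∫ u_j u_l θ = ∫ (v_j ⋆ v_l) 𝓕θ`
(`integral_physLp_mul_physLp_mul`). [cite: Lemarierieusset2023, §8.7 (8.8) (PDF p. 198)] -/
theorem quad {τ : ℝ} (hτ : τ ∈ Icc 0 T) (θ : 𝓢(ℝ³, ℂ)) (j l : Fin 3) :
    ∫ x, ((h.field τ x j : ℝ) : ℂ) * ((h.field τ x l : ℝ) : ℂ) * θ x =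
      ∫ ζ, fconv (fun ξ => v τ ξ j) (fun ξ => v τ ξ l) ζ * 𝓕 (θ : ℝ³ → ℂ) ζ := by
  rw [← integral_physLp_mul_physLp_mul (h.sol.measurable_slice τ) (h.sol.sq_lt_top hτ) θ j l,
    ← h.sol.physClass_eq hτ]
  refine integral_congr_ae ?_
  filter_upwards [h.ofReal_field_ae_eq hτ, h.sol.physClass_conj_ae hτ] with x h1 h2
  rw [h1 j, h1 l, h2 j, h2 l]

/-! ### Weak divergence-freeness of the field -/

/-- **The field is weakly divergence free** at every `t ∈ [0, T]`: `∫ ⟪u(t), ∇θ⟫ = 0`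
(`⟪u, ∇θ⟫ ↦ ∑ v_l 2πi ζ_l 𝓕θ^ℂ` and `ξ · v(t,ξ) = 0` a.e.). [cite: Lemarierieusset2023, §8.7 (8.8) (PDF p. 198)] -/
theorem isWeaklyDivFree_field {t : ℝ} (ht : t ∈ Icc 0 T) : IsWeaklyDivFree (h.field t) := by
  classical
  intro θ hθ
  have hpair := h.pair ht (P := fun x => ⟪h.field t x, gradient θ x⟫_ℝ)
    (fun l => ∂_{EuclideanSpace.single l (1 : ℝ)} (scalarSchwartz hθ))
    (fun x => inner_gradient_eq_sum hθ x (h.field t x))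
  have hzero : ∫ ζ : ℝ³, ∑ l, v t ζ l *
      𝓕 ((∂_{EuclideanSpace.single l (1 : ℝ)} (scalarSchwartz hθ) : 𝓢(ℝ³, ℂ)) : ℝ³ → ℂ) ζ = 0 := by
    refine integral_eq_zero_of_ae ?_
    filter_upwards [h.sol.divFree t ht] with ζ hζ
    have hterm : ∀ l, v t ζ l * 𝓕 ((∂_{EuclideanSpace.single l (1 : ℝ)} (scalarSchwartz hθ) :
        𝓢(ℝ³, ℂ)) : ℝ³ → ℂ) ζ =
        (2 * π * Complex.I) * 𝓕 (scalarSchwartz hθ : ℝ³ → ℂ) ζ * (((ζ l : ℝ) : ℂ) * v t ζ l) := fun l => by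
      rw [← SchwartzMap.fourier_coe, fourier_lineDerivOp_single_apply, SchwartzMap.fourier_coe]
      ring
    simp only [Pi.zero_apply]
    rw [Finset.sum_congr rfl fun l _ => hterm l, ← Finset.mul_sum, hζ, mul_zero]
  rw [hzero] at hpair
  exact_mod_cast hpair

/-! ### Measurability and the `L²` class -/

/-- **Joint measurability of the field** on `(0, T) × ℝ³` (it is `Re` of the jointly measurable
version there). [folklore] -/
theorem aestronglyMeasurable_field :
    AEStronglyMeasurable (uncurry h.field) (volume.restrict (Ioo 0 T ×ˢ (univ : Set ℝ³))) := by
  have hm : Measurable fun p : ℝ × ℝ³ => reC (h.version p.1 p.2) :=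
    continuous_reC.measurable.comp h.measurable_version
  refine (hm.aestronglyMeasurable.congr ?_)
  refine (ae_restrict_mem (measurableSet_Ioo.prod MeasurableSet.univ)).mono fun p hp => ?_
  have hp0 : p.1 ≠ 0 := ne_of_gt hp.1.1
  simp [uncurry, field, if_neg hp0]

/-- The field is in `L²` at every `t ∈ [0, T]`, with complexification the physical class. [folklore] -/
theorem memLp_complexify_field {t : ℝ} (ht : t ∈ Icc 0 T) :
    MemLp (FunctionSpaces.EuclideanSpace.complexify ∘ h.field t) 2 (volume : Measure ℝ³) :=
  (Lp.memLp (h.sol.physClass t)).ae_eq (h.complexify_field_ae_eq ht).symm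

/-- The `L²` class of the complexified field is the physical class. [folklore] -/
theorem toLp_complexify_field {t : ℝ} (ht : t ∈ Icc 0 T) :
    (h.memLp_complexify_field ht).toLp _ = h.sol.physClass t :=
  Lp.ext ((MemLp.coeFn_toLp _).trans (h.complexify_field_ae_eq ht))

/-- The time slices of the field are a.e. strongly measurable. [folklore] -/
theorem aestronglyMeasurable_field_slice {t : ℝ} (ht : t ∈ Icc 0 T) :
    AEStronglyMeasurable (h.field t) (volume : Measure ℝ³) := by
  have h1 := continuous_reC.comp_aestronglyMeasurable (h.memLp_complexify_field ht).1
  refine h1.congr (Eventually.of_forall fun x => ?_)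
  simp only [Function.comp_apply]
  exact reC_complexify (h.field t x)

/-- **The field is in `L²`** at every `t ∈ [0, T]`. [folklore] -/
theorem memLp_field {t : ℝ} (ht : t ∈ Icc 0 T) : MemLp (h.field t) 2 (volume : Measure ℝ³) :=
  MemLp.of_le (h.memLp_complexify_field ht) (h.aestronglyMeasurable_field_slice ht)
    (Eventually.of_forall fun x => by simp)

/-- The `L²` distance of two slices of the field is that of the physical classes, hence controlled
by the Fourier side: `‖u(t) − u(t₀)‖_{L²} ≤ 3 (∫⁻ ‖v(t) − v(t₀)‖²)^{1/2}`. [folklore] -/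
theorem eLpNorm_field_sub_le {t t₀ : ℝ} (ht : t ∈ Icc 0 T) (ht₀ : t₀ ∈ Icc 0 T) :
    eLpNorm (h.field t - h.field t₀) 2 (volume : Measure ℝ³) ≤
      (Fintype.card (Fin 3) : ℝ≥0∞) * (∫⁻ ξ, ‖v t ξ - v t₀ ξ‖ₑ ^ 2) ^ (1 / 2 : ℝ) := by
  refine le_trans (le_of_eq ?_) (h.sol.edist_physClass_le ht ht₀)
  rw [Lp.edist_def]
  refine eLpNorm_congr_norm_ae ?_
  filter_upwards [h.complexify_field_ae_eq ht, h.complexify_field_ae_eq ht₀] with x h1 h2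
  rw [Pi.sub_apply, Pi.sub_apply, ← h1, ← h2, Function.comp_apply, Function.comp_apply, ← map_sub,
    FunctionSpaces.EuclideanSpace.norm_complexify]

/-- **The field is in `C([0,T); L²)`** (`ContinuousInLpOn (Ico 0 T) 2`; from `tendsto_sq`). [cite: Lemarierieusset2023, Thm. 7.4 (A) (PDF p. 151)] -/
theorem continuousInLpOn_field : ContinuousInLpOn (Ico 0 T) 2 h.field := by
  refine ⟨fun t ht => h.memLp_field (Ico_subset_Icc_self ht), fun t₀ ht₀ => ?_⟩
  have ht₀' : t₀ ∈ Icc 0 T := Ico_subset_Icc_self ht₀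
  have h0 : Tendsto (fun t => (Fintype.card (Fin 3) : ℝ≥0∞) * (∫⁻ ξ, ‖v t ξ - v t₀ ξ‖ₑ ^ 2) ^ (1 / 2 : ℝ))
      (𝓝[Ico 0 T] t₀) (𝓝 0) := by
    have h1 := (ENNReal.continuous_rpow_const (y := (1 / 2 : ℝ))).tendsto 0
    rw [ENNReal.zero_rpow_of_pos (by norm_num)] at h1
    have h2 := h1.comp ((h.sol.tendsto_sq t₀ ht₀').mono_left (nhdsWithin_mono _ Ico_subset_Icc_self))
    have h3 := ENNReal.Tendsto.const_mul h2 (Or.inr (ENNReal.natCast_ne_top _))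
      (a := (Fintype.card (Fin 3) : ℝ≥0∞))
    rw [mul_zero] at h3
    exact h3
  refine tendsto_of_tendsto_of_tendsto_of_le_of_le' tendsto_const_nhds h0
    (Eventually.of_forall fun t => zero_le) ?_
  filter_upwards [eventually_mem_nhdsWithin] with t ht
  exact h.eLpNorm_field_sub_le (Ico_subset_Icc_self ht) ht₀'

/-! ### The `Ḣ^{1/2}` class -/

/-- The Fourier transform of the complexified field: `𝓕 u(t)^ℂ = v(t,-·)` a.e. [folklore] -/
theorem fourier_toLp_field_ae_eq {t : ℝ} (ht : t ∈ Icc 0 T) :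
    ((𝓕 ((h.memLp_complexify_field ht).toLp _) : Lp ℂ³ 2 (volume : Measure ℝ³)) : ℝ³ → ℂ³) =ᵐ[volume]
      negEuc (v t) := by
  rw [h.toLp_complexify_field ht, h.sol.physClass_eq ht]
  exact coeFn_fourier_physLp _ _

omit h in
/-- The complexification is additive on fields. [folklore] -/
theorem complexify_comp_sub (f g : ℝ³ → ℝ³) :
    (FunctionSpaces.EuclideanSpace.complexify ∘ (f - g)) =
      FunctionSpaces.EuclideanSpace.complexify ∘ f - FunctionSpaces.EuclideanSpace.complexify ∘ g := by
  funext x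
  simp [map_sub]

/-- The complexified difference of two slices is in `L²`. [folklore] -/
theorem memLp_complexify_field_sub {t t₀ : ℝ} (ht : t ∈ Icc 0 T) (ht₀ : t₀ ∈ Icc 0 T) :
    MemLp (FunctionSpaces.EuclideanSpace.complexify ∘ (h.field t - h.field t₀)) 2 (volume : Measure ℝ³) := by
  rw [complexify_comp_sub]
  exact (h.memLp_complexify_field ht).sub (h.memLp_complexify_field ht₀)

/-- Its `L²` class is the difference of the physical classes. [folklore] -/
theorem toLp_complexify_field_sub {t t₀ : ℝ} (ht : t ∈ Icc 0 T) (ht₀ : t₀ ∈ Icc 0 T) :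
    (h.memLp_complexify_field_sub ht ht₀).toLp _ = h.sol.physClass t - h.sol.physClass t₀ := by
  rw [← h.toLp_complexify_field ht, ← h.toLp_complexify_field ht₀, ← MemLp.toLp_sub]
  exact MemLp.toLp_congr _ _ (Eventually.of_forall fun x => by rw [complexify_comp_sub])

/-- The Fourier transform of the complexified difference: `v(t,-·) − v(t₀,-·)` a.e. [folklore] -/
theorem fourier_toLp_field_sub_ae_eq {t t₀ : ℝ} (ht : t ∈ Icc 0 T) (ht₀ : t₀ ∈ Icc 0 T) :
    ((𝓕 ((h.memLp_complexify_field_sub ht ht₀).toLp _) : Lp ℂ³ 2 (volume : Measure ℝ³)) : ℝ³ → ℂ³) =ᵐ[volume]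
      negEuc (fun ξ => v t ξ - v t₀ ξ) := by
  rw [h.toLp_complexify_field_sub ht ht₀,
    show ((𝓕 (h.sol.physClass t - h.sol.physClass t₀)) : Lp ℂ³ 2 (volume : Measure ℝ³)) =
      𝓕 (h.sol.physClass t) - 𝓕 (h.sol.physClass t₀) from
      (Lp.fourierTransformₗᵢ ℝ³ ℂ³).map_sub _ _]
  filter_upwards [Lp.coeFn_sub ((𝓕 (h.sol.physClass t)) : Lp ℂ³ 2 (volume : Measure ℝ³))
      ((𝓕 (h.sol.physClass t₀)) : Lp ℂ³ 2 (volume : Measure ℝ³)),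
    (h.sol.physClass_eq ht) ▸ coeFn_fourier_physLp (h.sol.measurable_slice t) (h.sol.sq_lt_top ht),
    (h.sol.physClass_eq ht₀) ▸ coeFn_fourier_physLp (h.sol.measurable_slice t₀) (h.sol.sq_lt_top ht₀)]
    with ξ h1 h2 h3
  rw [h1, Pi.sub_apply, h2, h3]
  simp [negEuc, toEuc_sub]

omit h in
/-- Weighted square integrals on the Fourier side of the reflected field. [folklore] -/
theorem lintegral_weight_sq_le_of_ae_eq {G : ℝ³ → ℂ³} {w : ℝ³ → Fin 3 → ℂ} (hG : G =ᵐ[volume] negEuc w) (s : ℝ) :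
    ∫⁻ ξ, ‖ξ‖ₑ ^ s * ‖G ξ‖ₑ ^ 2 ≤ (Fintype.card (Fin 3) : ℝ≥0∞) ^ 2 * ∫⁻ ξ, ‖ξ‖ₑ ^ s * ‖w ξ‖ₑ ^ 2 := by
  rw [lintegral_congr_ae (hG.mono fun ξ hξ => by rw [hξ])]
  calc ∫⁻ ξ, ‖ξ‖ₑ ^ s * ‖negEuc w ξ‖ₑ ^ 2
      ≤ ∫⁻ ξ : ℝ³, ‖ξ‖ₑ ^ s * ((Fintype.card (Fin 3) : ℝ≥0∞) ^ 2 * ‖w (-ξ)‖ₑ ^ 2) :=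
        lintegral_mono fun ξ => by
          gcongr
          rw [negEuc, ← mul_pow]
          gcongr
          exact enorm_toEuc_le _
    _ = (Fintype.card (Fin 3) : ℝ≥0∞) ^ 2 * ∫⁻ ξ : ℝ³, ‖-ξ‖ₑ ^ s * ‖w (-ξ)‖ₑ ^ 2 := by
        rw [← lintegral_const_mul' _ _ (ENNReal.pow_ne_top (ENNReal.natCast_ne_top _))]
        refine lintegral_congr fun ξ => ?_
        rw [enorm_neg]
        ring
    _ = (Fintype.card (Fin 3) : ℝ≥0∞) ^ 2 * ∫⁻ ξ, ‖ξ‖ₑ ^ s * ‖w ξ‖ₑ ^ 2 := by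
        rw [lintegral_neg_eq_self (fun ξ : ℝ³ => ‖ξ‖ₑ ^ s * ‖w ξ‖ₑ ^ 2)]

/-- **The field is in `Ḣ^{1/2} ∩ L²`** at every `t ∈ [0, T]` (`MemHomSobolev (1/2)`; from
`weighted_lt_top`). [cite: Lemarierieusset2023, Thm. 7.4 (A) (PDF p. 151)] -/
theorem memHomSobolev_field {t : ℝ} (ht : t ∈ Icc 0 T) :
    FunctionSpaces.MemHomSobolev (1 / 2 : ℝ) (FunctionSpaces.EuclideanSpace.complexify ∘ h.field t) := by
  refine ⟨h.memLp_complexify_field ht, ?_⟩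
  set G : ℝ³ → ℂ³ := ((𝓕 ((h.memLp_complexify_field ht).toLp _) : Lp ℂ³ 2 (volume : Measure ℝ³)) : ℝ³ → ℂ³)
    with hGdef
  have hGm : Measurable G := (Lp.stronglyMeasurable _).measurable
  refine memLp_two_of_lintegral_sq_lt_top hGm.aestronglyMeasurable ?_
  rw [FunctionSpaces.homSobolevMeasure_def, lintegral_withDensity_eq_lintegral_mul _
    (measurable_enorm.pow_const _) (hGm.enorm.pow_const 2)]
  calc ∫⁻ ξ, ((fun ξ : ℝ³ => ‖ξ‖ₑ ^ (2 * (1 / 2 : ℝ))) * fun ξ => ‖G ξ‖ₑ ^ 2) ξ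
      = ∫⁻ ξ : ℝ³, ‖ξ‖ₑ ^ (1 : ℝ) * ‖G ξ‖ₑ ^ 2 := lintegral_congr fun ξ => by norm_num
    _ ≤ (Fintype.card (Fin 3) : ℝ≥0∞) ^ 2 * ∫⁻ ξ : ℝ³, ‖ξ‖ₑ ^ (1 : ℝ) * ‖v t ξ‖ₑ ^ 2 :=
        lintegral_weight_sq_le_of_ae_eq (h.fourier_toLp_field_ae_eq ht) _
    _ < ∞ := by
        simp only [ENNReal.rpow_one]
        exact ENNReal.mul_lt_top (ENNReal.pow_lt_top (ENNReal.natCast_lt_top _)) (h.sol.weighted_lt_top t ht)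

/-- The `Ḣ^{1/2}` distance of two slices is controlled by the Fourier side:
`‖u(t) − u(t₀)‖_{Ḣ^{1/2}} ≤ 3 (∫⁻ ‖ξ‖ ‖v(t) − v(t₀)‖²)^{1/2}`. [folklore] -/
theorem eHomSobolevSeminorm_field_sub_le {t t₀ : ℝ} (ht : t ∈ Icc 0 T) (ht₀ : t₀ ∈ Icc 0 T) :
    Function.eHomSobolevSeminorm (1 / 2 : ℝ) (FunctionSpaces.EuclideanSpace.complexify ∘ (h.field t - h.field t₀)) ≤
      (Fintype.card (Fin 3) : ℝ≥0∞) * (∫⁻ ξ, ‖ξ‖ₑ * ‖v t ξ - v t₀ ξ‖ₑ ^ 2) ^ (1 / 2 : ℝ) := by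
  rw [Function.eHomSobolevSeminorm, dif_pos (h.memLp_complexify_field_sub ht ht₀),
    FunctionSpaces.eHomSobolevSeminorm]
  calc (∫⁻ ξ : ℝ³, ‖ξ‖ₑ ^ (2 * (1 / 2 : ℝ)) *
        ‖((𝓕 ((h.memLp_complexify_field_sub ht ht₀).toLp _) : Lp ℂ³ 2 (volume : Measure ℝ³)) : ℝ³ → ℂ³) ξ‖ₑ ^ 2) ^
          (1 / 2 : ℝ)
      ≤ ((Fintype.card (Fin 3) : ℝ≥0∞) ^ 2 * ∫⁻ ξ : ℝ³, ‖ξ‖ₑ ^ (2 * (1 / 2 : ℝ)) * ‖v t ξ - v t₀ ξ‖ₑ ^ 2) ^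
          (1 / 2 : ℝ) := by
        gcongr
        exact lintegral_weight_sq_le_of_ae_eq (h.fourier_toLp_field_sub_ae_eq ht ht₀) _
    _ = (Fintype.card (Fin 3) : ℝ≥0∞) * (∫⁻ ξ, ‖ξ‖ₑ * ‖v t ξ - v t₀ ξ‖ₑ ^ 2) ^ (1 / 2 : ℝ) := by
        rw [ENNReal.mul_rpow_of_nonneg _ _ (by norm_num), ← ENNReal.rpow_natCast, ← ENNReal.rpow_mul]
        norm_num

/-- **The field is in `C([0,T); Ḣ^{1/2} ∩ L²)`** (`ContinuousInHomSobolevOn (Ico 0 T) (1/2)`; from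
`tendsto_weighted`). [cite: Lemarierieusset2023, Thm. 7.4 (A) (PDF p. 151)] -/
theorem continuousInHomSobolevOn_field : ContinuousInHomSobolevOn (Ico 0 T) (1 / 2 : ℝ) h.field := by
  refine ⟨fun t ht => h.memHomSobolev_field (Ico_subset_Icc_self ht), fun t₀ ht₀ => ?_⟩
  have ht₀' : t₀ ∈ Icc 0 T := Ico_subset_Icc_self ht₀
  have h0 : Tendsto (fun t => (Fintype.card (Fin 3) : ℝ≥0∞) * (∫⁻ ξ, ‖ξ‖ₑ * ‖v t ξ - v t₀ ξ‖ₑ ^ 2) ^ (1 / 2 : ℝ))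
      (𝓝[Ico 0 T] t₀) (𝓝 0) := by
    have h1 := (ENNReal.continuous_rpow_const (y := (1 / 2 : ℝ))).tendsto 0
    rw [ENNReal.zero_rpow_of_pos (by norm_num)] at h1
    have h2 := h1.comp ((h.sol.tendsto_weighted t₀ ht₀').mono_left (nhdsWithin_mono _ Ico_subset_Icc_self))
    have h3 := ENNReal.Tendsto.const_mul h2 (Or.inr (ENNReal.natCast_ne_top _))
      (a := (Fintype.card (Fin 3) : ℝ≥0∞))
    rw [mul_zero] at h3
    exact h3
  refine tendsto_of_tendsto_of_tendsto_of_le_of_le' tendsto_const_nhds h0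
    (Eventually.of_forall fun t => zero_le) ?_
  filter_upwards [eventually_mem_nhdsWithin] with t ht
  exact h.eHomSobolevSeminorm_field_sub_le (Ico_subset_Icc_self ht) ht₀'

end DictHyp

end Field

/-! ### Fourier-side algebra of the nonlinear term -/

section Algebra

/-- **The convolution of coefficients is commutative** (a measure-preserving change of variables;
no integrability needed). Twin of `FourierNS.fconv_comm` (`NSFourierAPriori.lean`, not imported:
its closure is the disjoint Leray-regular development). [folklore] -/
theorem fconv_comm' (f g : ℝ³ → ℂ) (ζ : ℝ³) : fconv f g ζ = fconv g f ζ := by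
  rw [fconv_apply, fconv_apply, ← integral_sub_left_eq_self (fun η => g η * f (ζ - η)) volume ζ]
  refine integral_congr_ae (Eventually.of_forall fun η => ?_)
  simp only [sub_sub_cancel]
  ring

/-- **The Leray symbol drops out against a divergence-free test field**: with
`X j k = (v_j ⋆ v_k)(ζ)` and `∑_l ζ_l Φ_l = 0`,
`∑_l Φ_l N(v,v)(ζ)_l = -2πi ∑_{j,k} ζ_j Φ_k X j k` (Lemarié-Rieusset 2023, (8.8): the projector
`Id − ξ⊗ξ/|ξ|²` is the identity on vectors orthogonal to `ξ`). [cite: Lemarierieusset2023, §8.7 (8.8) (PDF p. 198)] -/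
theorem sum_mul_nonlin_eq (w : ℝ³ → Fin 3 → ℂ) (Φ : Fin 3 → ℂ) (ζ : ℝ³)
    (hΦ : ∑ l, ((ζ l : ℝ) : ℂ) * Φ l = 0) :
    ∑ l, Φ l * nonlin w w ζ l =
      -(2 * π * Complex.I) * ∑ j, ∑ k, ((ζ j : ℝ) : ℂ) * Φ k * fconv (w · j) (w · k) ζ := by
  classical
  -- `∑_l Φ_l m_{jkl} = ζ_j Φ_k`
  have hkey : ∀ j k, ∑ l, Φ l * (lerayDerivSymbol j k l ζ : ℂ) = ((ζ j : ℝ) : ℂ) * Φ k := by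
    intro j k
    have h1 : ∀ l, Φ l * (lerayDerivSymbol j k l ζ : ℂ) =
        ((ζ j : ℝ) : ℂ) * (if k = l then Φ l else 0) -
          ((ζ j : ℝ) : ℂ) * ((ζ k : ℝ) : ℂ) / ((‖ζ‖ ^ 2 : ℝ) : ℂ) * (((ζ l : ℝ) : ℂ) * Φ l) := by
      intro l
      rw [lerayDerivSymbol_apply]
      split_ifs with hkl
      · push_cast
        ring
      · push_cast
        ring
    simp_rw [h1]
    rw [Finset.sum_sub_distrib, ← Finset.mul_sum, ← Finset.mul_sum, Finset.sum_ite_eq, if_pos (Finset.mem_univ _),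
      hΦ, mul_zero, sub_zero]
  simp only [nonlin_apply, Finset.mul_sum]
  rw [Finset.sum_comm]
  refine Finset.sum_congr rfl fun j _ => ?_
  rw [Finset.sum_comm]
  refine Finset.sum_congr rfl fun k _ => ?_
  calc ∑ l, Φ l * (-(2 * π * Complex.I) * ((lerayDerivSymbol j k l ζ : ℂ) * fconv (w · j) (w · k) ζ))
      = -(2 * π * Complex.I) * fconv (w · j) (w · k) ζ * ∑ l, Φ l * (lerayDerivSymbol j k l ζ : ℂ) := by
        rw [Finset.mul_sum]
        exact Finset.sum_congr rfl fun l _ => by ring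
    _ = -(2 * π * Complex.I) * (((ζ j : ℝ) : ℂ) * Φ k * fconv (w · j) (w · k) ζ) := by
        rw [hkey j k]
        ring

/-- The nonlinear duality integrand on the Fourier side: with `K = 2πi`, `S = e^{-(2π)²νσ‖ζ‖²}`,
`∑_{l,j} (v_l ⋆ v_j)(ζ) (K ζ_j (S Φ_l(ζ))) = -S ∑_l Φ_l(ζ) N(v,v)(ζ)_l`. [cite: Lemarierieusset2023, §8.7 (8.8) (PDF p. 198)] -/
theorem sum_sum_fconv_mul_eq (w : ℝ³ → Fin 3 → ℂ) (Φ : Fin 3 → ℂ) (S : ℂ) (ζ : ℝ³)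
    (hΦ : ∑ l, ((ζ l : ℝ) : ℂ) * Φ l = 0) :
    ∑ l, ∑ j, fconv (w · l) (w · j) ζ * ((2 * π * Complex.I) * ((ζ j : ℝ) : ℂ) * (S * Φ l)) =
      -(S * ∑ l, Φ l * nonlin w w ζ l) := by
  have hL : ∑ l, ∑ j, fconv (w · l) (w · j) ζ * ((2 * π * Complex.I) * ((ζ j : ℝ) : ℂ) * (S * Φ l)) =
      (2 * π * Complex.I) * S * ∑ j, ∑ k, ((ζ j : ℝ) : ℂ) * Φ k * fconv (w · j) (w · k) ζ := by
    rw [Finset.mul_sum, Finset.sum_comm]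
    refine Finset.sum_congr rfl fun j _ => ?_
    rw [Finset.mul_sum]
    refine Finset.sum_congr rfl fun k _ => ?_
    rw [fconv_comm']
    ring
  rw [hL, sum_mul_nonlin_eq w Φ ζ hΦ]
  ring

end Algebra

/-! ### The nonlinear duality term on the Fourier side -/

section Nonlinear

variable {ν T : ℝ} {u₀ : ℝ³ → ℝ³} {a : ℝ³ → Fin 3 → ℂ} {v : ℝ → ℝ³ → Fin 3 → ℂ}

/-- **Cauchy–Schwarz for the envelope convolution**: `(|w| ⋆ |w|)(ζ) ≤ ∫⁻ |w|²` (Hölder for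
`lintegral`, `p = q = 2`, and translation invariance; the twin for Mathlib's `⋆ₗ` is the tree's
`FourierNS.lconv_le_sqrt_mul_sqrt`, `FourierL2Convolution.lean`). [folklore] -/
theorem lconv_enorm_le_lintegral_sq {w : ℝ³ → Fin 3 → ℂ} (hw : Measurable w) (ζ : ℝ³) :
    lconv (fun η => ‖w η‖ₑ) (fun η => ‖w η‖ₑ) ζ ≤ ∫⁻ η, ‖w η‖ₑ ^ 2 := by
  rw [lconv_apply]
  have hf : AEMeasurable (fun η : ℝ³ => ‖w (ζ - η)‖ₑ) volume :=
    (hw.comp (measurable_const.sub measurable_id)).enorm.aemeasurable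
  have h := ENNReal.lintegral_mul_le_Lp_mul_Lq (volume : Measure ℝ³) Real.HolderConjugate.two_two hf
    hw.enorm.aemeasurable
  have hsub : ∫⁻ η : ℝ³, ‖w (ζ - η)‖ₑ ^ (2 : ℝ) = ∫⁻ η, ‖w η‖ₑ ^ (2 : ℝ) :=
    lintegral_sub_left_eq_self (fun η => ‖w η‖ₑ ^ (2 : ℝ)) ζ
  rw [hsub, ← ENNReal.rpow_add_of_nonneg _ _ (by norm_num) (by norm_num)] at h
  norm_num at h
  exact h

namespace DictHyp

variable (h : DictHyp ν T u₀ a v)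
include h

/-- The uniform `L²` bound of the Fourier-side slices. [folklore] -/
theorem lintegral_sq_le_bound : ∃ C : ℝ≥0, ∀ t ∈ Icc 0 T, ∫⁻ ξ, ‖v t ξ‖ₑ ^ 2 ≤ C := h.sol.sq_le

/-- The chosen uniform `L²` bound. [folklore] -/
def sqBound : ℝ≥0 := h.lintegral_sq_le_bound.choose

/-- The bound bounds. [folklore] -/
theorem lintegral_sq_le_sqBound {t : ℝ} (ht : t ∈ Icc 0 T) : ∫⁻ ξ, ‖v t ξ‖ₑ ^ 2 ≤ h.sqBound :=
  h.lintegral_sq_le_bound.choose_spec t ht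

/-- **Uniform bound of the nonlinearity** on `[0, T]`: `‖N(v(t),v(t))(ζ)‖ ≤ C_N C ‖ζ‖`. [folklore] -/
theorem enorm_nonlin_slice_le {t : ℝ} (ht : t ∈ Icc 0 T) (ζ : ℝ³) :
    ‖nonlin (v t) (v t) ζ‖ₑ ≤ nonlinC (Fin 3) * h.sqBound * ‖ζ‖ₑ := by
  refine (enorm_nonlin_le (v t) (v t) ζ).trans ?_
  calc nonlinC (Fin 3) * ‖ζ‖ₑ * lconv (fun η => ‖v t η‖ₑ) (fun η => ‖v t η‖ₑ) ζ
      ≤ nonlinC (Fin 3) * ‖ζ‖ₑ * h.sqBound :=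
        mul_le_mul' le_rfl ((lconv_enorm_le_lintegral_sq (h.sol.measurable_slice t) ζ).trans
          (h.lintegral_sq_le_sqBound ht))
    _ = nonlinC (Fin 3) * h.sqBound * ‖ζ‖ₑ := by ring

/-- The same bound in real form. [folklore] -/
theorem norm_nonlin_slice_le {t : ℝ} (ht : t ∈ Icc 0 T) (ζ : ℝ³) :
    ‖nonlin (v t) (v t) ζ‖ ≤ (nonlinC (Fin 3) * h.sqBound).toReal * ‖ζ‖ := by
  have hfin : nonlinC (Fin 3) * h.sqBound ≠ ∞ := ENNReal.mul_ne_top nonlinC_ne_top ENNReal.coe_ne_top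
  have h1 := norm_le_toReal_of_enorm_le (ENNReal.mul_ne_top hfin enorm_ne_top) (h.enorm_nonlin_slice_le ht ζ)
  rwa [ENNReal.toReal_mul, toReal_enorm] at h1

/-- Coordinates of the field as complex `L²` functions. [folklore] -/
theorem memLp_ofReal_field {t : ℝ} (ht : t ∈ Icc 0 T) (k : Fin 3) :
    MemLp (fun x => ((h.field t x k : ℝ) : ℂ)) 2 (volume : Measure ℝ³) := by
  have h1 := (EuclideanSpace.proj (𝕜 := ℝ) k).comp_memLp' (h.memLp_field ht)
  have h2 := Complex.ofRealCLM.comp_memLp' h1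
  simpa [Function.comp_def] using h2

/-- The coefficient slices `s ↦ v(s,·)_k` are jointly measurable. [folklore] -/
theorem measurable_coeff (k : Fin 3) : Measurable (uncurry fun s η => v s η k) :=
  (measurable_pi_apply k).comp h.sol.measurable

/-- The frequency convolutions of a slice are measurable in the frequency. [folklore] -/
theorem measurable_fconv_slice (τ : ℝ) (l j : Fin 3) :
    Measurable fun ζ : ℝ³ => fconv (fun ξ => v τ ξ l) (fun ξ => v τ ξ j) ζ :=
  (measurable_fconv_uncurry (h.measurable_coeff l) (h.measurable_coeff j)).comp
    (f := fun ζ : ℝ³ => (τ, ζ)) (by fun_prop)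

/-- The frequency convolutions of a slice are bounded (Cauchy–Schwarz). [folklore] -/
theorem norm_fconv_slice_le {τ : ℝ} (hτ : τ ∈ Icc 0 T) (l j : Fin 3) (ζ : ℝ³) :
    ‖fconv (fun ξ => v τ ξ l) (fun ξ => v τ ξ j) ζ‖ ≤
      (eLpNorm (fun ξ => v τ ξ l) 2 volume * eLpNorm (fun ξ => v τ ξ j) 2 volume).toReal := by
  have hl := memLp_apply (h.sol.measurable_slice τ) (h.sol.sq_lt_top hτ) l
  have hj := memLp_apply (h.sol.measurable_slice τ) (h.sol.sq_lt_top hτ) j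
  exact norm_le_toReal_of_enorm_le (ENNReal.mul_ne_top hl.eLpNorm_ne_top hj.eLpNorm_ne_top)
    (enorm_fconv_le_eLpNorm_mul hl.1 hj.1 ζ)

/-- **The nonlinear duality term on the Fourier side**: for a divergence-free test field `φ`,
`τ ∈ [0, T]` and `σ ≥ 0`,
`∫ ⟪u(τ), (u(τ)·∇) e^{νσΔ}φ⟫ dx = -∫ e^{-(2π)²νσ‖ζ‖²} ∑_l Φ_l(ζ) N(v(τ),v(τ))(ζ)_l dζ`
(the quadratic pairing for each `∂_j(e^{νσΔ}φ)_l`, the Fourier transform of these derivatives,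
and the symbol algebra; Lemarié-Rieusset 2023, §8.7 (8.8)). [cite: Lemarierieusset2023, §8.7 (8.8) (PDF p. 198)] -/
theorem nonlinear_pairing {φ : ℝ³ → ℝ³} (hφ : FunctionSpaces.IsTestFunctionOn (⊤ : Opens ℝ³) φ)
    (hdivφ : VectorCalculus.IsDivFree φ) {τ σ : ℝ} (hτ : τ ∈ Icc 0 T) (hσ : 0 ≤ σ) :
    ((∫ x, ⟪h.field τ x, convect (h.field τ) (heatTest ν φ σ) x⟫_ℝ : ℝ) : ℂ) =
      -∫ ζ, (heatSymbol (ν * σ) ζ : ℂ) * ∑ l, 𝓕 (compSchwartz hφ l : ℝ³ → ℂ) ζ * nonlin (v τ) (v τ) ζ l := by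
  classical
  have hνσ : 0 ≤ ν * σ := mul_nonneg h.ν_pos.le hσ
  set u := h.field τ with hu
  set D : Fin 3 → Fin 3 → 𝓢(ℝ³, ℂ) := fun l j =>
    ∂_{EuclideanSpace.single j (1 : ℝ)} (caloricSchwartz hφ ν σ l) with hD
  -- Step A: the integrand in coordinates
  rw [show ((∫ x, ⟪u x, convect u (heatTest ν φ σ) x⟫_ℝ : ℝ) : ℂ) =
      ∫ x, ((⟪u x, convect u (heatTest ν φ σ) x⟫_ℝ : ℝ) : ℂ) from integral_ofReal.symm]
  simp_rw [convect_apply, inner_fderiv_heatTest_eq_sum hφ h.ν_pos hσ]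
  -- Step B: integrability of the terms
  have hint : ∀ l j, Integrable (fun x => ((u x l : ℝ) : ℂ) * ((u x j : ℝ) : ℂ) * D l j x) := by
    intro l j
    have h1 : Integrable (fun x => ((u x l : ℝ) : ℂ) * ((u x j : ℝ) : ℂ)) := by
      have := (h.memLp_ofReal_field hτ l).integrable_mul (h.memLp_ofReal_field hτ j)
      simpa only [Pi.mul_def] using this
    exact h1.mul_bdd (D l j).continuous.aestronglyMeasurable
      (Eventually.of_forall fun x => (D l j).toBoundedContinuousFunction.norm_coe_le_norm x)
  -- Step C/D: term by term to the Fourier side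
  have hterm : ∀ l j, ∫ x, ((u x l : ℝ) : ℂ) * ((u x j : ℝ) : ℂ) * D l j x =
      ∫ ζ, fconv (fun ξ => v τ ξ l) (fun ξ => v τ ξ j) ζ *
        ((2 * π * Complex.I) * ((ζ j : ℝ) : ℂ) *
          ((heatSymbol (ν * σ) ζ : ℂ) * 𝓕 (compSchwartz hφ l : ℝ³ → ℂ) ζ)) := by
    intro l j
    rw [hu, h.quad hτ (D l j) l j]
    refine integral_congr_ae (Eventually.of_forall fun ζ => ?_)
    rw [hD]
    dsimp only
    rw [fourier_lineDeriv_caloricSchwartz_apply hφ hνσ l j ζ]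
  -- Step E: integrability on the Fourier side
  have hint' : ∀ l j, Integrable (fun ζ : ℝ³ => fconv (fun ξ => v τ ξ l) (fun ξ => v τ ξ j) ζ *
      ((2 * π * Complex.I) * ((ζ j : ℝ) : ℂ) *
        ((heatSymbol (ν * σ) ζ : ℂ) * 𝓕 (compSchwartz hφ l : ℝ³ → ℂ) ζ))) := by
    intro l j
    have hg : Integrable (fun ζ : ℝ³ => (2 * π * Complex.I) * ((ζ j : ℝ) : ℂ) *
        ((heatSymbol (ν * σ) ζ : ℂ) * 𝓕 (compSchwartz hφ l : ℝ³ → ℂ) ζ)) := by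
      have h1 : Integrable (𝓕 (D l j) : 𝓢(ℝ³, ℂ)) := (𝓕 (D l j)).integrable
      refine h1.congr (Eventually.of_forall fun ζ => ?_)
      rw [SchwartzMap.fourier_coe, hD]
      dsimp only
      rw [fourier_lineDeriv_caloricSchwartz_apply hφ hνσ l j ζ]
    exact hg.bdd_mul (h.measurable_fconv_slice τ l j).aestronglyMeasurable
      (Eventually.of_forall (h.norm_fconv_slice_le hτ l j))
  -- assemble: sums of integrals to the integral of the sum, on both sides
  rw [integral_finsetSum _ fun l _ => integrable_finsetSum _ fun j _ => hint l j]
  have hstep : ∀ l, ∫ x, ∑ j, ((u x l : ℝ) : ℂ) * ((u x j : ℝ) : ℂ) * D l j x =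
      ∫ ζ, ∑ j, fconv (fun ξ => v τ ξ l) (fun ξ => v τ ξ j) ζ *
        ((2 * π * Complex.I) * ((ζ j : ℝ) : ℂ) *
          ((heatSymbol (ν * σ) ζ : ℂ) * 𝓕 (compSchwartz hφ l : ℝ³ → ℂ) ζ)) := fun l => by
    rw [integral_finsetSum _ fun j _ => hint l j, integral_finsetSum _ fun j _ => hint' l j]
    exact Finset.sum_congr rfl fun j _ => hterm l j
  rw [Finset.sum_congr rfl fun l _ => hstep l,
    ← integral_finsetSum _ fun l _ => integrable_finsetSum _ fun j _ => hint' l j, ← integral_neg]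
  refine integral_congr_ae (Eventually.of_forall fun ζ => ?_)
  exact sum_sum_fconv_mul_eq (v τ) (fun l => 𝓕 (compSchwartz hφ l : ℝ³ → ℂ) ζ) _ ζ
    (sum_coord_mul_fourier_compSchwartz hφ hdivφ ζ)

/-! ### The time integral: Fubini and the Duhamel formula -/

/-- The rate `c = (2π)²ν` is positive. [folklore] -/
theorem c_pos : 0 < (2 * π) ^ 2 * ν := by
  have := h.ν_pos
  positivity

/-- The Duhamel integrand `τ ↦ e^{-c‖ζ‖²(t-τ)} N(v(τ),v(τ))(ζ)` is measurable in `τ`. [folklore] -/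
theorem measurable_duhamel_integrand (t : ℝ) (ζ : ℝ³) :
    Measurable fun τ => heat ((2 * π) ^ 2 * ν) ζ (t - τ) • nonlin (v τ) (v τ) ζ := by
  have hN : Measurable fun τ => nonlin (v τ) (v τ) ζ :=
    (measurable_nonlin_uncurry h.sol.measurable h.sol.measurable).comp (f := fun τ : ℝ => (τ, ζ)) (by fun_prop)
  have hh : Measurable fun τ => heat ((2 * π) ^ 2 * ν) ζ (t - τ) := by
    unfold heat
    fun_prop
  refine measurable_pi_lambda _ fun l => ?_
  simp only [Pi.smul_apply, Complex.real_smul]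
  exact (Complex.measurable_ofReal.comp hh).mul ((measurable_pi_apply l).comp hN)

/-- The Duhamel integrand is bounded on `(0, t]`, `t ≤ T`: `‖e^{…} N‖ ≤ C_N C ‖ζ‖`. [folklore] -/
theorem norm_duhamel_integrand_le {t : ℝ} (ht : t ∈ Icc 0 T) {τ : ℝ} (hτ : τ ∈ Ioc 0 t) (ζ : ℝ³) :
    ‖heat ((2 * π) ^ 2 * ν) ζ (t - τ) • nonlin (v τ) (v τ) ζ‖ ≤ (nonlinC (Fin 3) * h.sqBound).toReal * ‖ζ‖ := by
  rw [norm_smul, Real.norm_of_nonneg (heat_nonneg _ _ _)]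
  calc heat ((2 * π) ^ 2 * ν) ζ (t - τ) * ‖nonlin (v τ) (v τ) ζ‖
      ≤ 1 * ‖nonlin (v τ) (v τ) ζ‖ := by
        gcongr
        exact heat_le_one h.c_pos.le (sub_nonneg.2 hτ.2) ζ
    _ ≤ (nonlinC (Fin 3) * h.sqBound).toReal * ‖ζ‖ := by
        rw [one_mul]
        exact h.norm_nonlin_slice_le ⟨hτ.1.le, hτ.2.trans ht.2⟩ ζ

/-- **The Duhamel integrand is integrable on `(0, t]`** at every frequency. [folklore] -/
theorem integrableOn_duhamel_integrand {t : ℝ} (ht : t ∈ Icc 0 T) (ζ : ℝ³) :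
    IntegrableOn (fun τ => heat ((2 * π) ^ 2 * ν) ζ (t - τ) • nonlin (v τ) (v τ) ζ) (Ioc 0 t) := by
  have hc : IntegrableOn (fun _ : ℝ => (nonlinC (Fin 3) * h.sqBound).toReal * ‖ζ‖) (Ioc 0 t) :=
    integrableOn_const (μ := volume) (s := Ioc 0 t) (C := (nonlinC (Fin 3) * h.sqBound).toReal * ‖ζ‖)
      measure_Ioc_lt_top.ne
  refine hc.mono' (h.measurable_duhamel_integrand t ζ).aestronglyMeasurable ?_
  rw [ae_restrict_iff' measurableSet_Ioc]
  exact ae_of_all _ fun τ hτ => h.norm_duhamel_integrand_le ht hτ ζ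

/-- **The Duhamel formula, integrated form**: for a.e. `ζ`,
`∫_{(0,t]} e^{-c‖ζ‖²(t-τ)} N(v(τ),v(τ))(ζ) dτ = e^{-c‖ζ‖²t} a(ζ) − v(t,ζ)`. [cite: Lemarierieusset2023, §8.7 (8.8) (PDF p. 198)] -/
theorem duhamel_setIntegral_ae {t : ℝ} (ht : t ∈ Icc 0 T) :
    ∀ᵐ ζ : ℝ³ ∂volume, ∫ τ in Ioc 0 t, heat ((2 * π) ^ 2 * ν) ζ (t - τ) • nonlin (v τ) (v τ) ζ =
      heat ((2 * π) ^ 2 * ν) ζ t • a ζ - v t ζ := by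
  filter_upwards [h.sol.duhamel t ht] with ζ hζ
  rw [← intervalIntegral.integral_of_le ht.1, hζ]
  abel

omit h in
/-- The paired Fourier-side integrand `H(τ, ζ) = e^{-c‖ζ‖²(t-τ)} ∑_l Φ_l(ζ) N(w(τ),w(τ))(ζ)_l`
(viscosity `nu`, Fourier-side field `w`). [folklore] -/
def pairedIntegrand (nu : ℝ) (w : ℝ → ℝ³ → Fin 3 → ℂ) {φ : ℝ³ → ℝ³}
    (hφ : FunctionSpaces.IsTestFunctionOn (⊤ : Opens ℝ³) φ) (t τ : ℝ) (ζ : ℝ³) : ℂ :=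
  (heat ((2 * π) ^ 2 * nu) ζ (t - τ) : ℂ) * ∑ l, 𝓕 (compSchwartz hφ l : ℝ³ → ℂ) ζ * nonlin (w τ) (w τ) ζ l

/-- **The inner time integral at a Duhamel frequency**:
`∫_{(0,t]} H(τ,ζ) dτ = ∑_l Φ_l(ζ) (e^{-c‖ζ‖²t} a(ζ)_l − v(t,ζ)_l)` for a.e. `ζ`. [cite: Lemarierieusset2023, §8.7 (8.8) (PDF p. 198)] -/
theorem setIntegral_pairedIntegrand_ae {φ : ℝ³ → ℝ³} (hφ : FunctionSpaces.IsTestFunctionOn (⊤ : Opens ℝ³) φ)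
    {t : ℝ} (ht : t ∈ Icc 0 T) :
    ∀ᵐ ζ : ℝ³ ∂volume, ∫ τ in Ioc 0 t, pairedIntegrand ν v hφ t τ ζ =
      ∑ l, 𝓕 (compSchwartz hφ l : ℝ³ → ℂ) ζ *
        ((heat ((2 * π) ^ 2 * ν) ζ t : ℂ) * a ζ l - v t ζ l) := by
  filter_upwards [h.duhamel_setIntegral_ae ht] with ζ hζ
  have hI := h.integrableOn_duhamel_integrand ht ζ
  -- the coordinates of the Duhamel integral
  have hcoord : ∀ l, ∫ τ in Ioc 0 t, (heat ((2 * π) ^ 2 * ν) ζ (t - τ) : ℂ) * nonlin (v τ) (v τ) ζ l =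
      (heat ((2 * π) ^ 2 * ν) ζ t : ℂ) * a ζ l - v t ζ l := by
    intro l
    have h1 := ((ContinuousLinearMap.proj (R := ℝ) (φ := fun _ : Fin 3 => ℂ) l).integral_comp_comm hI)
    simp only [ContinuousLinearMap.proj_apply, Pi.smul_apply, Complex.real_smul] at h1
    rw [h1, hζ]
    simp [Complex.real_smul]
  have hint : ∀ l, Integrable (fun τ => 𝓕 (compSchwartz hφ l : ℝ³ → ℂ) ζ *
      ((heat ((2 * π) ^ 2 * ν) ζ (t - τ) : ℂ) * nonlin (v τ) (v τ) ζ l)) (volume.restrict (Ioc 0 t)) := by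
    intro l
    have h1 := ((ContinuousLinearMap.proj (R := ℝ) (φ := fun _ : Fin 3 => ℂ) l).integrable_comp hI)
    have h2 : Integrable (fun τ => (heat ((2 * π) ^ 2 * ν) ζ (t - τ) : ℂ) * nonlin (v τ) (v τ) ζ l)
        (volume.restrict (Ioc 0 t)) := by
      refine h1.congr (Eventually.of_forall fun τ => ?_)
      simp [Complex.real_smul]
    exact h2.const_mul _
  unfold pairedIntegrand
  simp_rw [Finset.mul_sum]
  rw [show (fun τ => ∑ l, (heat ((2 * π) ^ 2 * ν) ζ (t - τ) : ℂ) *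
      (𝓕 (compSchwartz hφ l : ℝ³ → ℂ) ζ * nonlin (v τ) (v τ) ζ l)) =
      fun τ => ∑ l, 𝓕 (compSchwartz hφ l : ℝ³ → ℂ) ζ *
        ((heat ((2 * π) ^ 2 * ν) ζ (t - τ) : ℂ) * nonlin (v τ) (v τ) ζ l) from
      funext fun τ => Finset.sum_congr rfl fun l _ => by ring,
    integral_finsetSum _ fun l _ => hint l]
  refine Finset.sum_congr rfl fun l _ => ?_
  rw [integral_const_mul, hcoord l]

/-- **Integrability of the paired integrand on `(0,t] × ℝ³`** (domination by
`C_N C ‖ζ‖ ∑_l |Φ_l(ζ)|`, integrable since `Φ_l` is Schwartz; measurability from the joint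
measurability of `v`). [folklore] -/
theorem integrable_pairedIntegrand {φ : ℝ³ → ℝ³} (hφ : FunctionSpaces.IsTestFunctionOn (⊤ : Opens ℝ³) φ)
    {t : ℝ} (ht : t ∈ Icc 0 T) :
    Integrable (uncurry (pairedIntegrand ν v hφ t)) ((volume.restrict (Ioc 0 t)).prod (volume : Measure ℝ³)) := by
  set K : ℝ := (nonlinC (Fin 3) * h.sqBound).toReal with hK
  set Φf : Fin 3 → ℝ³ → ℂ := fun l => 𝓕 (compSchwartz hφ l : ℝ³ → ℂ) with hΦf
  have hΦf_eq : ∀ l, Φf l = ((𝓕 (compSchwartz hφ l) : 𝓢(ℝ³, ℂ)) : ℝ³ → ℂ) := fun l => by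
    rw [hΦf, SchwartzMap.fourier_coe]
  -- measurability
  have hmeas : Measurable (uncurry (pairedIntegrand ν v hφ t)) := by
    have hh : Measurable fun p : ℝ × ℝ³ => (heat ((2 * π) ^ 2 * ν) p.2 (t - p.1) : ℂ) :=
      Complex.measurable_ofReal.comp (by unfold heat; fun_prop)
    have hΦ : ∀ l, Measurable fun p : ℝ × ℝ³ => Φf l p.2 := fun l => by
      rw [hΦf_eq]
      exact (𝓕 (compSchwartz hφ l)).continuous.measurable.comp measurable_snd
    have hN : ∀ l, Measurable fun p : ℝ × ℝ³ => nonlin (v p.1) (v p.1) p.2 l := fun l =>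
      (measurable_pi_apply l).comp (measurable_nonlin_uncurry h.sol.measurable h.sol.measurable)
    exact hh.mul (Finset.measurable_sum _ fun l _ => (hΦ l).mul (hN l))
  -- the dominating function
  have hζint : Integrable (fun ζ : ℝ³ => ‖ζ‖ * ∑ l, ‖Φf l ζ‖) := by
    have h1 : ∀ l, Integrable (fun ζ : ℝ³ => ‖ζ‖ * ‖Φf l ζ‖) := fun l => by
      have := (𝓕 (compSchwartz hφ l)).integrable_pow_mul (volume : Measure ℝ³) 1
      simpa [hΦf_eq] using this
    have h2 := integrable_finsetSum Finset.univ fun l _ => h1 l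
    refine h2.congr (Eventually.of_forall fun ζ => ?_)
    simp [Finset.mul_sum]
  have hBint : Integrable (fun p : ℝ × ℝ³ => K * (‖p.2‖ * ∑ l, ‖Φf l p.2‖))
      ((volume.restrict (Ioc 0 t)).prod (volume : Measure ℝ³)) := by
    refine Integrable.const_mul ?_ K
    have hgc : Continuous (fun ζ : ℝ³ => ‖ζ‖ * ∑ l, ‖Φf l ζ‖) := by
      refine continuous_norm.mul (continuous_finsetSum _ fun l _ => ?_)
      rw [hΦf_eq]
      exact (𝓕 (compSchwartz hφ l)).continuous.norm
    have hm : AEStronglyMeasurable (fun p : ℝ × ℝ³ => ‖p.2‖ * ∑ l, ‖Φf l p.2‖)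
        ((volume.restrict (Ioc 0 t)).prod (volume : Measure ℝ³)) :=
      (hgc.comp continuous_snd).aestronglyMeasurable
    refine (integrable_prod_iff hm).2 ⟨ae_of_all _ fun τ => hζint, ?_⟩
    simp
  -- points of the product have `τ ∈ (0, t]` almost surely
  have hae : ∀ᵐ p ∂((volume.restrict (Ioc 0 t)).prod (volume : Measure ℝ³)), p.1 ∈ Ioc 0 t := by
    have heq : ((volume.restrict (Ioc 0 t)).prod (volume : Measure ℝ³)) =
        ((volume : Measure ℝ).prod (volume : Measure ℝ³)).restrict (Ioc 0 t ×ˢ univ) := by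
      conv_lhs => rw [← Measure.restrict_univ (μ := (volume : Measure ℝ³))]
      rw [Measure.prod_restrict]
    rw [heq]
    filter_upwards [ae_restrict_mem (measurableSet_Ioc.prod MeasurableSet.univ)] with p hp using hp.1
  refine hBint.mono' hmeas.aestronglyMeasurable ?_
  filter_upwards [hae] with p hp
  have hτT : p.1 ∈ Icc 0 T := ⟨hp.1.le, hp.2.trans ht.2⟩
  simp only [uncurry, pairedIntegrand]
  rw [norm_mul, Complex.norm_real, Real.norm_of_nonneg (heat_nonneg _ _ _)]
  calc heat ((2 * π) ^ 2 * ν) p.2 (t - p.1) * ‖∑ l, Φf l p.2 * nonlin (v p.1) (v p.1) p.2 l‖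
      ≤ 1 * ∑ l, ‖Φf l p.2‖ * ‖nonlin (v p.1) (v p.1) p.2‖ := by
        refine mul_le_mul (heat_le_one h.c_pos.le (sub_nonneg.2 hp.2) _)
          ((norm_sum_le _ _).trans (Finset.sum_le_sum fun l _ => ?_)) (norm_nonneg _) zero_le_one
        rw [norm_mul]
        exact mul_le_mul_of_nonneg_left (norm_le_pi_norm _ l) (norm_nonneg _)
    _ ≤ 1 * ∑ l, ‖Φf l p.2‖ * (K * ‖p.2‖) := by
        gcongr with l
        exact h.norm_nonlin_slice_le hτT p.2
    _ = K * (‖p.2‖ * ∑ l, ‖Φf l p.2‖) := by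
        rw [one_mul, ← Finset.sum_mul]
        ring

/-- The Fourier data is measurable. [folklore] -/
theorem measurable_data : Measurable a := by
  rw [← h.sol.initial]
  exact h.sol.measurable_slice 0

omit h in
/-- Pairings of the data and of the slices with Schwartz coefficients are integrable. [folklore] -/
theorem integrable_sum_mul {w : ℝ³ → Fin 3 → ℂ} (hw : Measurable w) (hw2 : ∫⁻ ξ, ‖w ξ‖ₑ ^ 2 < ∞)
    (Ψ : Fin 3 → 𝓢(ℝ³, ℂ)) : Integrable (fun ζ => ∑ l, Ψ l ζ * w ζ l) :=
  integrable_finsetSum _ fun l _ => by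
    have := ((Ψ l).memLp 2 (volume : Measure ℝ³)).integrable_mul (memLp_apply hw hw2 l)
    simpa only [Pi.mul_def] using this

/-- **The time integral of the nonlinear duality term**:
`∫₀ᵗ ∫ ⟪u(τ), (u(τ)·∇) e^{ν(t-τ)Δ}φ⟫ dx dτ = ∫ ∑_l Φ_l v(t)_l − ∫ e^{-ct‖ζ‖²} ∑_l Φ_l a_l`
(the nonlinear pairing at each `τ`, Fubini over `(0,t] × ℝ³`, and the Duhamel formula a.e. in `ζ`;
Lemarié-Rieusset 2023, §8.7 (8.8)). [cite: Lemarierieusset2023, §8.7 (8.8) (PDF p. 198)] -/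
theorem time_integral {φ : ℝ³ → ℝ³} (hφ : FunctionSpaces.IsTestFunctionOn (⊤ : Opens ℝ³) φ)
    (hdivφ : VectorCalculus.IsDivFree φ) {t : ℝ} (ht : t ∈ Icc 0 T) :
    ((∫ τ in (0 : ℝ)..t, ∫ x, ⟪h.field τ x, convect (h.field τ) (heatTest ν φ (t - τ)) x⟫_ℝ : ℝ) : ℂ) =
      (∫ ζ, ∑ l, 𝓕 (compSchwartz hφ l : ℝ³ → ℂ) ζ * v t ζ l) -
        ∫ ζ, (heat ((2 * π) ^ 2 * ν) ζ t : ℂ) * ∑ l, 𝓕 (compSchwartz hφ l : ℝ³ → ℂ) ζ * a ζ l := by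
  rw [← intervalIntegral.integral_ofReal]
  have hcongr : ∫ τ in (0 : ℝ)..t, ((∫ x, ⟪h.field τ x, convect (h.field τ) (heatTest ν φ (t - τ)) x⟫_ℝ : ℝ) : ℂ) =
      ∫ τ in (0 : ℝ)..t, -∫ ζ, pairedIntegrand ν v hφ t τ ζ := by
    refine intervalIntegral.integral_congr fun τ hτ => ?_
    rw [uIcc_of_le ht.1] at hτ
    have hτT : τ ∈ Icc 0 T := ⟨hτ.1, hτ.2.trans ht.2⟩
    rw [h.nonlinear_pairing hφ hdivφ hτT (sub_nonneg.2 hτ.2)]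
    congr 1
    refine integral_congr_ae (Eventually.of_forall fun ζ => ?_)
    simp only [pairedIntegrand, heatSymbol_eq_heat]
  rw [hcongr, intervalIntegral.integral_neg, intervalIntegral.integral_of_le ht.1,
    integral_integral_swap (h.integrable_pairedIntegrand hφ ht),
    integral_congr_ae (h.setIntegral_pairedIntegrand_ae hφ ht)]
  -- split the frequency integral
  have h0 : (0 : ℝ) ∈ Icc 0 T := ⟨le_rfl, ht.1.trans ht.2⟩
  have hA : Integrable (fun ζ : ℝ³ => (heat ((2 * π) ^ 2 * ν) ζ t : ℂ) *
      ∑ l, 𝓕 (compSchwartz hφ l : ℝ³ → ℂ) ζ * a ζ l) := by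
    have h1 : Integrable (fun ζ : ℝ³ => ∑ l, 𝓕 (compSchwartz hφ l : ℝ³ → ℂ) ζ * a ζ l) := by
      have := integrable_sum_mul h.measurable_data (h.sol.initial ▸ h.sol.sq_lt_top h0)
        (fun l => 𝓕 (compSchwartz hφ l))
      simpa [SchwartzMap.fourier_coe] using this
    refine h1.bdd_mul (c := 1) (Complex.measurable_ofReal.comp (by unfold heat; fun_prop)).aestronglyMeasurable
      (Eventually.of_forall fun ζ => ?_)
    rw [Complex.norm_real, Real.norm_of_nonneg (heat_nonneg _ _ _)]
    exact heat_le_one h.c_pos.le ht.1 ζ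
  have hV : Integrable (fun ζ : ℝ³ => ∑ l, 𝓕 (compSchwartz hφ l : ℝ³ → ℂ) ζ * v t ζ l) := by
    have := integrable_sum_mul (h.sol.measurable_slice t) (h.sol.sq_lt_top ht) (fun l => 𝓕 (compSchwartz hφ l))
    simpa [SchwartzMap.fourier_coe] using this
  rw [show (fun ζ : ℝ³ => ∑ l, 𝓕 (compSchwartz hφ l : ℝ³ → ℂ) ζ *
      ((heat ((2 * π) ^ 2 * ν) ζ t : ℂ) * a ζ l - v t ζ l)) =
      fun ζ => (heat ((2 * π) ^ 2 * ν) ζ t : ℂ) * ∑ l, 𝓕 (compSchwartz hφ l : ℝ³ → ℂ) ζ * a ζ l -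
        ∑ l, 𝓕 (compSchwartz hφ l : ℝ³ → ℂ) ζ * v t ζ l from funext fun ζ => by
      rw [Finset.mul_sum, ← Finset.sum_sub_distrib]
      exact Finset.sum_congr rfl fun l _ => by ring,
    integral_sub hA hV]
  ring

/-! ### Assembly of the duality identity -/

omit h in
/-- The real inner product of `ℝ³` in complexified coordinates (complexification of the tree's
`FourierNS.inner_eq_sum'`, `NSFourierSolution.lean`, not imported). [folklore] -/
theorem ofReal_inner_eq_sum (w y : ℝ³) :
    ((⟪w, y⟫_ℝ : ℝ) : ℂ) = ∑ l, ((w l : ℝ) : ℂ) * ((y l : ℝ) : ℂ) := by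
  rw [PiLp.inner_apply, Complex.ofReal_sum]
  refine Finset.sum_congr rfl fun l _ => ?_
  rw [show ⟪w l, y l⟫_ℝ = w l * y l from by simp [mul_comm], Complex.ofReal_mul]

/-- **The left-hand side**: `∫ ⟪u(t), φ⟫ = ∫ ∑_l Φ_l v(t)_l`. [cite: Lemarierieusset2023, §8.7 (8.8) (PDF p. 198)] -/
theorem lhs_pairing {φ : ℝ³ → ℝ³} (hφ : FunctionSpaces.IsTestFunctionOn (⊤ : Opens ℝ³) φ)
    {t : ℝ} (ht : t ∈ Icc 0 T) :
    ((∫ x, ⟪h.field t x, φ x⟫_ℝ : ℝ) : ℂ) = ∫ ζ, ∑ l, 𝓕 (compSchwartz hφ l : ℝ³ → ℂ) ζ * v t ζ l := by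
  rw [h.pair ht (P := fun x => ⟪h.field t x, φ x⟫_ℝ) (fun l => compSchwartz hφ l)
    (fun x => by rw [ofReal_inner_eq_sum]; rfl)]
  exact integral_congr_ae (Eventually.of_forall fun ζ => Finset.sum_congr rfl fun l _ => mul_comm _ _)

/-- **The datum term**: `∫ ⟪u₀, e^{νtΔ}φ⟫ = ∫ e^{-ct‖ζ‖²} ∑_l Φ_l a_l`. [cite: Lemarierieusset2023, §8.7 (8.8) (PDF p. 198)] -/
theorem datum_pairing {φ : ℝ³ → ℝ³} (hφ : FunctionSpaces.IsTestFunctionOn (⊤ : Opens ℝ³) φ)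
    {t : ℝ} (ht : t ∈ Icc 0 T) :
    ((∫ x, ⟪u₀ x, heatTest ν φ t x⟫_ℝ : ℝ) : ℂ) =
      ∫ ζ, (heat ((2 * π) ^ 2 * ν) ζ t : ℂ) * ∑ l, 𝓕 (compSchwartz hφ l : ℝ³ → ℂ) ζ * a ζ l := by
  have h0 : (0 : ℝ) ∈ Icc 0 T := ⟨le_rfl, ht.1.trans ht.2⟩
  have hνt : 0 ≤ ν * t := mul_nonneg h.ν_pos.le ht.1
  rw [h.pair h0 (P := fun x => ⟪u₀ x, heatTest ν φ t x⟫_ℝ) (fun l => caloricSchwartz hφ ν t l)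
    (fun x => by
      rw [h.field_zero, ofReal_inner_eq_sum]
      exact Finset.sum_congr rfl fun l _ => by rw [caloricSchwartz_apply hφ h.ν_pos ht.1 l x])]
  refine integral_congr_ae (Eventually.of_forall fun ζ => ?_)
  simp only [h.sol.initial, Finset.mul_sum]
  refine Finset.sum_congr rfl fun l _ => ?_
  rw [fourier_caloricSchwartz_apply hφ hνt l ζ, heatSymbol_eq_heat]
  ring

/-- **The duality identity from the datum** (`IsMildNSSolutionFrom ν 0 u₀ u t`) for `t ∈ [0, T]`:
`∫ ⟪u(t), φ⟫ = ∫ ⟪u₀, e^{νtΔ}φ⟫ + ∫₀ᵗ ∫ ⟪u, (u·∇) e^{ν(t-τ)Δ}φ⟫` for smooth compactly supported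
divergence-free `φ` (Fabes–Jones–Rivière 1972, Thm. 2.1, through the Fourier dictionary of
Lemarié-Rieusset 2023, §8.7 (8.8)). [cite: Lemarierieusset2023, §8.7 (8.8) (PDF p. 198) and Thm. 6.1] -/
theorem isMildNSSolutionFrom_field {t : ℝ} (ht : t ∈ Icc 0 T) : IsMildNSSolutionFrom ν 0 u₀ h.field t := by
  intro φ hφ hdivφ
  have hL := h.lhs_pairing hφ ht
  have hR1 := h.datum_pairing hφ ht
  have hR2 := h.time_integral hφ hdivφ ht
  have hR3 : (∫ τ in (0 : ℝ)..t, ∫ x, ⟪(0 : ℝ → ℝ³ → ℝ³) τ x, heatTest ν φ (t - τ) x⟫_ℝ) = 0 := by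
    simp
  apply Complex.ofReal_injective
  rw [hR3, add_zero, Complex.ofReal_add, hL, hR1, hR2]
  ring

/-- **The field is a duality-form mild solution on `[0, T)`** with datum `u₀`. [cite: Lemarierieusset2023, §8.7 (8.8) (PDF p. 198) and Thm. 6.1] -/
theorem isMildNSSolutionOn_field : IsMildNSSolutionOn (Ico 0 T) ν 0 u₀ h.field :=
  ⟨fun _ ht => h.isWeaklyDivFree_field (Ico_subset_Icc_self ht),
    fun _ ht => h.isMildNSSolutionFrom_field (Ico_subset_Icc_self ht)⟩

end DictHyp

end Nonlinear

/-! ### The dictionary fact and `fujita_kato_local` -/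

/-- **Fourier-side Fujita–Kato solutions are duality-form mild solutions in
`C([0,T); Ḣ^{1/2} ∩ L²)`** (discharge of the named fact
`exists_mildSolution_of_isFourierNSSolution` of `FujitaKatoLocal.lean`; the dictionary of
Lemarié-Rieusset 2023, §8.7, (8.8), PDF p. 198, read backwards through Plancherel, with Thm. 6.1 /
Fabes–Jones–Rivière 1972, Thm. 2.1 for the tested form): the physical field is `DictHyp.field`. [cite: Lemarierieusset2023, §8.7 (8.8) (PDF p. 198) and Thm. 6.1] -/
theorem exists_mildSolution_of_isFourierNSSolution_holds : exists_mildSolution_of_isFourierNSSolution := by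
  intro ν T hν hT u₀ hu₀ hdiv a v ha hv
  have h : DictHyp ν T u₀ a v := ⟨hν, hT, hu₀, hdiv, ha, hv⟩
  exact ⟨h.field, h.field_zero, h.isMildNSSolutionOn_field, h.continuousInHomSobolevOn_field,
    h.continuousInLpOn_field, h.aestronglyMeasurable_field⟩

end Literature.Analysis.FluidPDE.FujitaKato

namespace Literature.Analysis.FluidPDE

/-- **ns.S14, Fujita–Kato local existence in `Ḣ^{1/2} ∩ L²(ℝ³)` — discharge of the named fact
`fujita_kato_local`** (`MildSolutions.lean`): for `ν > 0` and a weakly divergence-free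
`u₀ ∈ Ḣ^{1/2} ∩ L²` there are `T > 0` and a duality-form mild solution
`u ∈ C([0,T); Ḣ^{1/2} ∩ L²)` of the unforced Navier–Stokes equations with `u(0) = u₀`, measurable on
`(0,T) × ℝ³`. Proof: the Fourier-side fixed point of the "cheap Navier–Stokes" majorant scheme
(`FujitaKato.fourier_fujitaKato_local_holds`, Lemarié-Rieusset 2023, §8.8, PDF pp. 207–210) and
the dictionary to physical mild solutions (`FujitaKato.exists_mildSolution_of_isFourierNSSolution_holds`,
§8.7 (8.8), PDF p. 198), assembled by `FujitaKato.fujita_kato_local_of`; the book states the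
result as Thm. 7.4 (A), PDF p. 151 (`H^{1/2} = L² ∩ Ḣ^{1/2}`). [cite: Lemarierieusset2023, Thm. 7.4 (A) (PDF p. 151) and §8.8 (PDF p. 210)] -/
theorem fujita_kato_local_holds : fujita_kato_local :=
  FujitaKato.fujita_kato_local_of FujitaKato.fourier_fujitaKato_local_holds
    FujitaKato.exists_mildSolution_of_isFourierNSSolution_holds

end Literature.Analysis.FluidPDE
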